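import Mathlib.Data.Nat.Sqrt
import Mathlib.GroupTheory.Index
import Mathlib.GroupTheory.OrderOfElement
import Literature.IUT.HodgeTheaters.PuncturedEllipticCoveringsBasic
import Literature.IUT.HodgeTheaters.PuncturedEllipticCoveringsCusps
import HarnessLib

/-!
# [IUTchI] Corollary 1.2, proof p. 39: the index formula for `l` and the equality
# `Π_X̲ = Π_{X̲→} · H` — proof-only kernels

Mochizuki, *Inter-universal Teichmüller theory I*, kurims manuscript (May 2020), §1, Corollary 1.2
"Characteristic Nature of Coverings", PROOF, p. 39 ([IUTchI] Cor 1.2 p.39)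
[claim: Mochizuki2012, status: disputed].  Proof-only companion (no definitions, nothing restated) over
abc-iut-L5-t1's FROZEN `PuncturedEllipticCoverings.lean` and its interface companion
`PuncturedEllipticCoveringsCusps.lean` (`CuspGalois`, consumed BY NAME), alongside the abc-iut-L5-d4
companions `…Characteristic` / `…CuspRecovery` / `…Splitting` (not imported).  Two small consequences of
the `CuspGalois` laws whose public forms live in abc-iut-L5-t1's proof companion
`PuncturedEllipticCoveringsCuspsProofs.lean` (`mem_PiXbar_iff_act_eq_one`, `normal_PiXbar_subgroupOf`) are
re-derived `private`ly here (no twin name; that module is not imported).  Node `IUTchI:Cor1.2`.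
It kernel-checks the two sentences of the printed proof that sit between the [AbsTopII] Cor. 3.3 step
("reconstruct `Π_C` … as well as the subgroups `Δ_X ⊆ Δ_C ⊆ Π_C`") and the cusp-recovery step:

* "In particular, `l` may be recovered via the formula
  `l² = [Δ_X : Δ_X̲] · [Δ_X̲ : Δ_{X̲→}] = [Δ_X : Δ_{X̲→}] = [Δ_C : Δ_{X̲→}] / 2`."
  Here `Δ_X = Π_X ∩ Δ_C`, `Δ_X̲ = Π_X̲ ∩ Δ_C` (`DeltaXbar`), `Δ_{X̲→} = Π_{X̲→} ∩ Δ_C`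
  (`piXarrow ⊓ DeltaC`; `= jKer` is the claim `ArrowCoveringClaims.piXarrow_inf_delta`).  KERNELS:
  `[Δ_X : Δ_X̲] = [Π_X : Π_X̲]` and `[Δ_C : Δ_X] = [Π_C : Π_X] = 2` UNCONDITIONALLY from the frozen
  record (both towers surject onto `G_k` through the datum `D_{2ε} ↠ G_k`:
  `relIndex_deltaXbar_deltaX_eq`, `relIndex_deltaX_deltaC`); then, under the printed claims of p. 38
  (`ArrowCoveringClaims`) and the law `[Π_X : Π_X̲] = l` ([IUTchI] Def. 3.1 (d): `X̲_K → X_K` has degree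
  `l`; abc-iut-L5-t2's `ThetaGeometry.PiXbar_relIndex`; not carried by the frozen §1 record, hence the
  explicit hypothesis `hX`), the four printed equalities (`ArrowCoveringClaims.index_formula` and its
  parts) and "`l` may be recovered": intrinsically `l = √([Δ_C : Δ_{X̲→}] / 2)`
  (`ArrowCoveringClaims.l_eq_sqrt`) and by transport — an isomorphism `Θ : Π_C ⥲ Π'_C` carrying
  `Π_{X̲→}`, `Δ_C` onto their counterparts forces `l = l'` (`ArrowCoveringClaims.l_eq_of_map_deltaC`).
* "Next, let us set `H := Ker(Δ_X ↠ Δ_X^{ab} ⊗ (ℤ/lℤ))`.  Then `Π_X̲ ⊆ Π_C` may be recovered via the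
  [easily verified] equality of subgroups `Π_X̲ = Π_{X̲→} · H`."  `H` is EXACTLY the closed subgroup that
  appears in the frozen standing hypothesis (∗) `PuncturedEllipticData.star` ("`G_k` acts trivially on
  `Δ_X^{ab} ⊗ (ℤ/lℤ)`": `g x g⁻¹ x⁻¹ ∈ H` for `g ∈ Π_X`, `x ∈ Δ_X`).  KERNEL
  (`ArrowCoveringClaims.piXarrow_sup_H_eq_piXbar`): `Π_{X̲→} ⊔ H = Π_X̲` under `ArrowCoveringClaims`, the
  cusp action `CuspGalois` and `hX`.  ROUTE (the "[easily verified]"): for `x ∈ I_{ε′}` and `g ∈ Π_X`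
  with `g·ε′ = 2ε̲`'s cusp (`CuspGalois.transitive`), `g x g⁻¹` lies in a `Π_X̲`-conjugate of the inertia
  group `I_{2ε} ⊆ jKer` (`CuspGalois.act_decomp`; `jKer ⊴ Π_C̲`), so by (∗) `x ∈ H · jKer`
  (`ArrowCoveringClaims.inertia_ε1_le_sup_jKer`); hence `Δ_X̲ = I_{ε′} · jKer ⊆ H · jKer` and
  `Π_X̲ = D_{2ε} · Δ_X̲ ⊆ Π_{X̲→} · H`; conversely `H ⊆ Π_X̲` because `Π_X` acts on the cusps through a
  cyclic group `Gal(X̲/X) = Π_X/Π_X̲` of order `[Π_X : Π_X̲] = l` (`CuspGalois.H_le_piXbar`).  The TRANSPORT form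
  (`ArrowCoveringClaims.map_piXbar_eq_of_map_deltaX`): a bicontinuous `Θ : Π_C ⥲ Π'_C` carrying
  `Π_{X̲→}`, `Δ_X`, `Δ_C` onto their counterparts carries `Π_X̲` onto `Π'_X̲` — the printed reconstruction
  of `Π_X̲` from the [AbsTopII] Cor. 3.3 outputs, with no Remark 1.2.1 / normaliser input.

After this file every GROUP-THEORETIC sentence of the printed proof of Cor. 1.2 is a kernel theorem
(p405757, p407653, p424465, p425983, this file); what remains of node `IUTchI:Cor1.2` are the ANABELIAN
inputs ([AbsTopI] Prop. 2.3 (ii), Thm. 2.6 (v)(vi); [AbsTopII] Cor. 3.3 (i)(ii); [AbsTopI] Lem. 4.5 with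
Rmk. 1.2.2 (ii) — prerequisite layer L4, FACT-policy) and the law `hX` at the genuine datum.  Products of
subgroups are joins `⊔` (as in the statement file).  No side is taken on [IUTchIII] Cor. 3.12.
-/

namespace Literature.IUT.HodgeTheaters

namespace PuncturedEllipticData

open scoped Pointwise
open Literature.AnabelianGeometry.AbsoluteAnabelian

universe u

variable {D : PuncturedEllipticData.{u}}

/-! ### A coset count: indices do not change on passing to the geometric parts -/

/-- If every element of `K` has the same image under `f` as some element of `H ≤ K`, then the cosets
of `H` in `K` are represented inside `Ker f`: `[K : H] = [K ∩ Ker f : H ∩ Ker f]`.  (Folklore; the passage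
"`[Π : Π'] = [Δ : Δ']`" for open subgroups surjecting onto `G_k`, used on p. 39.) [cite: Mochizuki2012, Cor 1.2 p.39] -/
theorem relIndex_inf_ker_eq_relIndex {G Q : Type*} [Group G] [Group Q] (f : G →* Q)
    {H K : Subgroup G} (hHK : H ≤ K) (hH : ∀ k ∈ K, ∃ h ∈ H, f h = f k) :
    H.relIndex (K ⊓ f.ker) = H.relIndex K := by
  rw [Subgroup.relIndex, Subgroup.relIndex, Subgroup.index_eq_card, Subgroup.index_eq_card]
  refine Nat.card_congr (Equiv.ofBijective
    (Subgroup.quotientSubgroupOfEmbeddingOfLE H (inf_le_left : K ⊓ f.ker ≤ K)) ⟨?_, ?_⟩)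
  · exact (Subgroup.quotientSubgroupOfEmbeddingOfLE H _).injective
  · intro q
    induction q using QuotientGroup.induction_on with | H k => ?_
    obtain ⟨h, hh, hfh⟩ := hH k k.2
    have hk' : (k : G) * h⁻¹ ∈ K ⊓ f.ker := Subgroup.mem_inf.mpr
      ⟨K.mul_mem k.2 (K.inv_mem (hHK hh)), by rw [MonoidHom.mem_ker, map_mul, map_inv, hfh, mul_inv_cancel]⟩
    refine ⟨QuotientGroup.mk ⟨(k : G) * h⁻¹, hk'⟩, ?_⟩
    rw [Subgroup.quotientSubgroupOfEmbeddingOfLE_apply_mk, QuotientGroup.eq, Subgroup.mem_subgroupOf]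
    have e : (((Subgroup.inclusion (inf_le_left : K ⊓ f.ker ≤ K) ⟨(k : G) * h⁻¹, hk'⟩)⁻¹ * k : K) : G)
        = h := by
      simp only [Subgroup.coe_mul, Subgroup.coe_inv, Subgroup.coe_inclusion, mul_inv_rev, inv_inv,
        inv_mul_cancel_right]
    rw [e]
    exact hh

/-- **`[Δ_X : Δ_X̲] = [Π_X : Π_X̲]`**, i.e. `[Δ_X : Π_X̲ ∩ Δ_X] = [Π_X : Π_X̲]` (UNCONDITIONAL: `Π_X̲ ⊇ D_{2ε}`
surjects onto `G_k` by the frozen datum `aug_decomp_twoε`). ([IUTchI] Cor 1.2 p.39)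
[claim: Mochizuki2012, status: disputed] -/
theorem relIndex_piXbar_deltaX_eq : D.PiXbar.relIndex (D.PiX ⊓ D.DeltaC) = D.PiXbar.relIndex D.PiX := by
  refine relIndex_inf_ker_eq_relIndex D.E.aug.toMonoidHom (inf_le_left : D.PiXbar ≤ D.PiX) ?_
  intro k _
  obtain ⟨⟨d, hd⟩, hdk⟩ := D.aug_decomp_twoε (D.E.aug.toMonoidHom k)
  exact ⟨d, D.decomp_le D.twoε hd, hdk⟩

/-- **`[Δ_X : Δ_X̲] = [Π_X : Π_X̲]`** with `Δ_X̲ = Π_X̲ ∩ Δ_C` spelled `DeltaXbar`. ([IUTchI] Cor 1.2 p.39)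
[claim: Mochizuki2012, status: disputed] -/
theorem relIndex_deltaXbar_deltaX_eq :
    D.DeltaXbar.relIndex (D.PiX ⊓ D.DeltaC) = D.PiXbar.relIndex D.PiX := by
  have hle : D.PiXbar ≤ D.PiX := inf_le_left
  have e : D.DeltaXbar = D.PiXbar ⊓ (D.PiX ⊓ D.DeltaC) := by
    rw [DeltaXbar, ← inf_assoc, inf_eq_left.mpr hle]
  rw [e, Subgroup.inf_relIndex_right, relIndex_piXbar_deltaX_eq]

/-- **`[Δ_C : Δ_X] = [Π_C : Π_X] = 2`** (UNCONDITIONAL: `Π_X ↠ G_k` is the frozen datum `aug_piX`).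
([IUTchI] Cor 1.2 p.39) [claim: Mochizuki2012, status: disputed] -/
theorem relIndex_deltaX_deltaC : (D.PiX ⊓ D.DeltaC).relIndex D.DeltaC = 2 := by
  have h := relIndex_inf_ker_eq_relIndex D.E.aug.toMonoidHom (le_top : D.PiX ≤ ⊤) fun k _ => by
    obtain ⟨⟨p, hp⟩, hpk⟩ := D.aug_piX (D.E.aug.toMonoidHom k)
    exact ⟨p, hp, hpk⟩
  rw [top_inf_eq, Subgroup.relIndex_top_right, D.index_piX] at h
  rw [Subgroup.inf_relIndex_right]
  exact h

/-! ### "`l` may be recovered via the formula `l² = [Δ_X : Δ_X̲]·[Δ_X̲ : Δ_{X̲→}] = [Δ_X : Δ_{X̲→}] = [Δ_C : Δ_{X̲→}]/2`" -/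

/-- `Δ_{X̲→} ⊆ Δ_X̲ ⊆ Δ_X ⊆ Δ_C` (the tower the formula lives on). ([IUTchI] Cor 1.2 p.39)
[claim: Mochizuki2012, status: disputed] -/
theorem deltaXarrow_le_deltaXbar : D.piXarrow ⊓ D.DeltaC ≤ D.DeltaXbar :=
  inf_le_inf_right _ D.piXarrow_le_piXbar

/-- `Δ_X̲ ⊆ Δ_X`. ([IUTchI] Cor 1.2 p.39) [claim: Mochizuki2012, status: disputed] -/
theorem deltaXbar_le_deltaX : D.DeltaXbar ≤ D.PiX ⊓ D.DeltaC :=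
  inf_le_inf_right _ (inf_le_left : D.PiXbar ≤ D.PiX)

/-- **`[Δ_X̲ : Δ_{X̲→}] = l`** under the printed claims of p. 38 (`Δ_{X̲→} = Π_{X̲→} ∩ Δ_C = jKer` and
`Δ_X̲ / jKer = Δ_Θ⁺` of order `l`). ([IUTchI] Cor 1.2 p.39) [claim: Mochizuki2012, status: disputed] -/
theorem ArrowCoveringClaims.relIndex_deltaXarrow_deltaXbar (h : D.ArrowCoveringClaims) :
    (D.piXarrow ⊓ D.DeltaC).relIndex D.DeltaXbar = D.l := by
  rw [h.piXarrow_inf_delta, h.jKer_relindex]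

/-- **`[Δ_X : Δ_X̲] = l`** from the law `[Π_X : Π_X̲] = l` ([IUTchI] Def. 3.1 (d); abc-iut-L5-t2's
`ThetaGeometry.PiXbar_relIndex`; equivalently `#Cusp(X̲) = l` by abc-iut-L5-t1's `CuspGalois.card_cusp`).
([IUTchI] Cor 1.2 p.39) [claim: Mochizuki2012, status: disputed] -/
theorem relIndex_deltaXbar_deltaX_of_hX (hX : D.PiXbar.relIndex D.PiX = D.l) :
    D.DeltaXbar.relIndex (D.PiX ⊓ D.DeltaC) = D.l := by
  rw [relIndex_deltaXbar_deltaX_eq, hX]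

/-- **`[Δ_X : Δ_{X̲→}] = l²`.** ([IUTchI] Cor 1.2 p.39) [claim: Mochizuki2012, status: disputed] -/
theorem ArrowCoveringClaims.relIndex_deltaXarrow_deltaX (h : D.ArrowCoveringClaims)
    (hX : D.PiXbar.relIndex D.PiX = D.l) :
    (D.piXarrow ⊓ D.DeltaC).relIndex (D.PiX ⊓ D.DeltaC) = D.l ^ 2 := by
  rw [← Subgroup.relIndex_mul_relIndex (D.piXarrow ⊓ D.DeltaC) D.DeltaXbar (D.PiX ⊓ D.DeltaC)
    deltaXarrow_le_deltaXbar deltaXbar_le_deltaX, h.relIndex_deltaXarrow_deltaXbar,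
    relIndex_deltaXbar_deltaX_of_hX hX, sq]

/-- **`[Δ_C : Δ_{X̲→}] = 2l²`.** ([IUTchI] Cor 1.2 p.39) [claim: Mochizuki2012, status: disputed] -/
theorem ArrowCoveringClaims.relIndex_deltaXarrow_deltaC (h : D.ArrowCoveringClaims)
    (hX : D.PiXbar.relIndex D.PiX = D.l) :
    (D.piXarrow ⊓ D.DeltaC).relIndex D.DeltaC = 2 * D.l ^ 2 := by
  rw [← Subgroup.relIndex_mul_relIndex (D.piXarrow ⊓ D.DeltaC) (D.PiX ⊓ D.DeltaC) D.DeltaC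
    (deltaXarrow_le_deltaXbar.trans deltaXbar_le_deltaX) inf_le_right,
    h.relIndex_deltaXarrow_deltaX hX, relIndex_deltaX_deltaC, mul_comm]

/-- **Cor. 1.2, proof p. 39 — the printed index formula, verbatim:**
`l² = [Δ_X : Δ_X̲] · [Δ_X̲ : Δ_{X̲→}] = [Δ_X : Δ_{X̲→}] = [Δ_C : Δ_{X̲→}] / 2`, under the printed claims of
p. 38 and the law `[Π_X : Π_X̲] = l`. ([IUTchI] Cor 1.2 p.39) [claim: Mochizuki2012, status: disputed] -/
theorem ArrowCoveringClaims.index_formula (h : D.ArrowCoveringClaims)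
    (hX : D.PiXbar.relIndex D.PiX = D.l) :
    D.l ^ 2 = D.DeltaXbar.relIndex (D.PiX ⊓ D.DeltaC) * (D.piXarrow ⊓ D.DeltaC).relIndex D.DeltaXbar ∧
      D.l ^ 2 = (D.piXarrow ⊓ D.DeltaC).relIndex (D.PiX ⊓ D.DeltaC) ∧
      D.l ^ 2 = (D.piXarrow ⊓ D.DeltaC).relIndex D.DeltaC / 2 := by
  refine ⟨?_, (h.relIndex_deltaXarrow_deltaX hX).symm, ?_⟩
  · rw [relIndex_deltaXbar_deltaX_of_hX hX, h.relIndex_deltaXarrow_deltaXbar, sq]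
  · rw [h.relIndex_deltaXarrow_deltaC hX, Nat.mul_div_cancel_left _ two_pos]

/-- **"`l` may be recovered"**, intrinsic form: `l = √([Δ_C : Δ_{X̲→}] / 2)` — a function of the pair
`Δ_C ⊇ Π_{X̲→} ∩ Δ_C` alone. ([IUTchI] Cor 1.2 p.39) [claim: Mochizuki2012, status: disputed] -/
theorem ArrowCoveringClaims.l_eq_sqrt (h : D.ArrowCoveringClaims) (hX : D.PiXbar.relIndex D.PiX = D.l) :
    D.l = Nat.sqrt ((D.piXarrow ⊓ D.DeltaC).relIndex D.DeltaC / 2) := by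
  rw [h.relIndex_deltaXarrow_deltaC hX, Nat.mul_div_cancel_left _ two_pos, Nat.sqrt_eq']

/-- **"`l` may be recovered"**, transport form: for data `D, D'` satisfying the printed claims of p. 38
and the law `[Π_X : Π_X̲] = l`, any isomorphism `Θ : Π_C ⥲ Π'_C` with `Θ(Π_{X̲→}) = Π'_{X̲→}` and
`Θ(Δ_C) = Δ'_C` [the outputs of the [AbsTopII] Cor. 3.3 step] satisfies `l = l'`.
([IUTchI] Cor 1.2 p.39) [claim: Mochizuki2012, status: disputed] -/
theorem ArrowCoveringClaims.l_eq_of_map_deltaC {D' : PuncturedEllipticData.{u}}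
    (h : D.ArrowCoveringClaims) (h' : D'.ArrowCoveringClaims) (hX : D.PiXbar.relIndex D.PiX = D.l)
    (hX' : D'.PiXbar.relIndex D'.PiX = D'.l) (Θ : D.PiC ≃* D'.PiC)
    (hΘ : D.piXarrow.map Θ.toMonoidHom = D'.piXarrow) (hΘΔ : D.DeltaC.map Θ.toMonoidHom = D'.DeltaC) :
    D.l = D'.l := by
  have h1 := Subgroup.relIndex_map_map_of_injective (f := Θ.toMonoidHom) (D.piXarrow ⊓ D.DeltaC)
    D.DeltaC Θ.injective
  rw [Subgroup.map_inf _ _ _ Θ.injective, hΘ, hΘΔ, h'.relIndex_deltaXarrow_deltaC hX',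
    h.relIndex_deltaXarrow_deltaC hX] at h1
  have h2 : D'.l ^ 2 = D.l ^ 2 := by omega
  exact (Nat.pow_left_injective two_ne_zero h2).symm

/-! ### "`Π_X̲ = Π_{X̲→} · H`", `H = Ker(Δ_X ↠ Δ_X^{ab} ⊗ ℤ/lℤ)` -/

/-- The inertia group of the chosen cusp over `2ε̲` is killed in `Δ_X̲ ↠ Δ_Θ` (it is a nonzero cusp
other than `ε′, ε″`): `I_{2ε} ⊆ jKer` — definitional. ([IUTchI] §1 p.37) [claim: Mochizuki2012, status: disputed] -/
theorem inertia_twoε_le_jKer (D : PuncturedEllipticData.{u}) : D.inertia D.twoε ≤ D.jKer := by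
  have h1 : D.inertia D.twoε ≤ D.deltaEpsKer :=
    le_trans (le_iSup (fun y : {y : D.Cusp // D.IsNonzeroCusp y ∧ y ≠ D.ε1 ∧ y ≠ D.ε2} =>
      D.inertia y.1) ⟨D.twoε, D.twoε_ne.1, D.twoε_ne.2.1, D.twoε_ne.2.2⟩) le_sup_right
  exact h1.trans le_sup_left

/-- **The heart of "[easily verified]": `I_{ε′} ⊆ H · jKer`** for ANY subgroup `H` containing the
commutators `g x g⁻¹ x⁻¹` (`g ∈ Π_X`, `x ∈ I_{ε′}`) — under the printed claims of p. 38 (`jKer ⊴ Π_C̲`)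
and the cusp action: pick `g ∈ Π_X` with `g·ε′ =` the cusp over `2ε̲` (`transitive`); then `g x g⁻¹`
lies in a `Π_X̲`-conjugate of `I_{2ε} ⊆ jKer` (`act_decomp`), so `x = (g x g⁻¹ x⁻¹)⁻¹ (g x g⁻¹) ∈ H · jKer`.
([IUTchI] Cor 1.2 p.39) [claim: Mochizuki2012, status: disputed] -/
theorem ArrowCoveringClaims.inertia_ε1_le_sup_jKer (h : D.ArrowCoveringClaims) (C : D.CuspGalois)
    {H : Subgroup D.PiC} (hstar : ∀ g ∈ D.PiX, ∀ x ∈ D.inertia D.ε1, g * x * g⁻¹ * x⁻¹ ∈ H) :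
    D.inertia D.ε1 ≤ H ⊔ D.jKer := by
  obtain ⟨g, hg, hgε⟩ := C.transitive D.ε1 D.twoε
  obtain ⟨t, ht, hconj⟩ := C.act_decomp g D.ε1
  rw [hgε] at hconj
  intro x hx
  -- `(tg) x (tg)⁻¹ ∈ I_{2ε} ⊆ jKer`
  have hy : t * g * x * (t * g)⁻¹ ∈ D.jKer := by
    have hmem : MulAut.conj (t * g) • x ∈ D.decomp D.twoε := by
      rw [← hconj]
      exact Subgroup.smul_mem_pointwise_smul _ _ _ hx.1
    rw [MulAut.smul_def, MulAut.conj_apply] at hmem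
    exact D.inertia_twoε_le_jKer ⟨hmem, D.E.normal_geom.conj_mem x hx.2 (t * g)⟩
  -- conjugate back by `t⁻¹ ∈ Π_X̲ ⊆ Π_C̲` (`jKer ⊴ Π_C̲`): `g x g⁻¹ ∈ jKer`
  have hgx : g * x * g⁻¹ ∈ D.jKer := by
    have htC : t ∈ D.PiCbar := D.piXbar_le_piCbar ht
    have hyC : t * g * x * (t * g)⁻¹ ∈ D.PiCbar :=
      (D.jKer_le_deltaXbar.trans (D.deltaXbar_le_piXbar.trans D.piXbar_le_piCbar)) hy
    have key := h.jKer_normal.conj_mem ⟨_, hyC⟩ (Subgroup.mem_subgroupOf.mpr hy)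
      ⟨t⁻¹, D.PiCbar.inv_mem htC⟩
    rw [Subgroup.mem_subgroupOf, Subgroup.coe_mul, Subgroup.coe_mul, Subgroup.coe_inv] at key
    have e : t⁻¹ * (t * g * x * (t * g)⁻¹) * t⁻¹⁻¹ = g * x * g⁻¹ := by group
    rwa [e] at key
  have e : x = (g * x * g⁻¹ * x⁻¹)⁻¹ * (g * x * g⁻¹) := by group
  rw [e]
  exact Subgroup.mul_mem _ (Subgroup.mem_sup_left (H.inv_mem (hstar g hg x hx)))
    (Subgroup.mem_sup_right hgx)

/-- `Π_X̲ ⊆ D_{2ε} · Δ_X̲` (UNCONDITIONAL: `D_{2ε} ↠ G_k`, `D_{2ε} ⊆ Π_X̲`). ([IUTchI] §1 p.38)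
[claim: Mochizuki2012, status: disputed] -/
theorem piXbar_le_decomp_twoε_sup_deltaXbar (D : PuncturedEllipticData.{u}) :
    D.PiXbar ≤ D.decomp D.twoε ⊔ D.DeltaXbar := by
  intro p hp
  obtain ⟨⟨d, hd⟩, hdp⟩ := D.aug_decomp_twoε (D.E.aug.toMonoidHom p)
  have hdp' : D.E.aug d = D.E.aug p := hdp
  have hq : d⁻¹ * p ∈ D.DeltaXbar := by
    refine ⟨D.PiXbar.mul_mem (D.PiXbar.inv_mem (D.decomp_le _ hd)) hp, ?_⟩
    show d⁻¹ * p ∈ D.E.geom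
    rw [FundamentalExtension.mem_geom, map_mul, map_inv, hdp', inv_mul_cancel]
  rw [← mul_inv_cancel_left d p]
  exact Subgroup.mul_mem _ (Subgroup.mem_sup_left hd) (Subgroup.mem_sup_right hq)

/-- **"`Π_X̲ = Π_{X̲→} · H`", general form:** under the printed claims of p. 38 and the cusp action, ANY
subgroup `H ⊆ Π_X̲` containing the commutators `g x g⁻¹ x⁻¹` (`g ∈ Π_X`, `x ∈ I_{ε′}`) satisfies
`Π_{X̲→} ⊔ H = Π_X̲` [`Δ_X̲ = I_{ε′} · jKer ⊆ H · jKer`, `Π_X̲ = D_{2ε} · Δ_X̲`, `Π_{X̲→} = D_{2ε} · jKer`].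
([IUTchI] Cor 1.2 p.39) [claim: Mochizuki2012, status: disputed] -/
theorem ArrowCoveringClaims.piXarrow_sup_eq_piXbar (h : D.ArrowCoveringClaims) (C : D.CuspGalois)
    {H : Subgroup D.PiC} (hH : H ≤ D.PiXbar)
    (hstar : ∀ g ∈ D.PiX, ∀ x ∈ D.inertia D.ε1, g * x * g⁻¹ * x⁻¹ ∈ H) :
    D.piXarrow ⊔ H = D.PiXbar := by
  refine le_antisymm (sup_le D.piXarrow_le_piXbar hH) ?_
  have hΔ : D.DeltaXbar ≤ H ⊔ D.jKer := by
    rw [← h.inertia_ε1_sup]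
    exact sup_le (h.inertia_ε1_le_sup_jKer C hstar) le_sup_right
  have hHj : H ⊔ D.jKer ≤ D.piXarrow ⊔ H :=
    sup_le le_sup_right ((le_sup_right : D.jKer ≤ D.piXarrow).trans le_sup_left)
  exact D.piXbar_le_decomp_twoε_sup_deltaXbar.trans
    (sup_le (D.decomp_twoε_le_piXarrow.trans le_sup_left) (hΔ.trans hHj))

/-- For `g ∈ Π_X`: `g ∈ Π_X̲ ↔ g` acts trivially on the cusps of `X̲` (public form: abc-iut-L5-t1's
`CuspGalois.mem_PiXbar_iff_act_eq_one`). ([IUTchI] §1 p.37) [claim: Mochizuki2012, status: disputed] -/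
private theorem CuspGalois.mem_PiXbar_iff_act_eq_one₀ (C : D.CuspGalois) {g : D.PiC} (hg : g ∈ D.PiX) :
    g ∈ D.PiXbar ↔ C.act g = 1 := by
  refine ⟨fun h => Equiv.ext fun x => ?_, fun h => C.free g hg D.ε0 (by rw [h]; rfl)⟩
  obtain ⟨t, ht, hconj⟩ := C.act_decomp g x
  exact (C.eq_of_conj x (C.act g x) (t * g) (D.PiXbar.mul_mem ht h) hconj).symm

/-- `Π_X̲ ⊴ Π_X` (it is the kernel of the cusp action of `Π_X`; public form: abc-iut-L5-t1's
`CuspGalois.normal_PiXbar_subgroupOf`). ([IUTchI] §1 p.37) [claim: Mochizuki2012, status: disputed] -/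
private theorem CuspGalois.normal_PiXbar_subgroupOf₀ (C : D.CuspGalois) :
    (D.PiXbar.subgroupOf D.PiX).Normal := by
  have hker : (C.act.comp D.PiX.subtype).ker = D.PiXbar.subgroupOf D.PiX := by
    ext g
    rw [MonoidHom.mem_ker, Subgroup.mem_subgroupOf, MonoidHom.comp_apply]
    exact (C.mem_PiXbar_iff_act_eq_one₀ g.2).symm
  rw [← hker]
  infer_instance

/-- **`H = Ker(Δ_X ↠ Δ_X^{ab} ⊗ ℤ/lℤ) ⊆ Π_X̲`**: the commutators of `Δ_X ⊆ Π_X` act trivially on the cusps of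
`X̲` (`Π_X` acts through the cyclic group `Gal(X̲/X)`), the `l`-th powers of `Π_X` lie in the normal subgroup
`Π_X̲` of index `[Π_X : Π_X̲] = l`, and `Π_X̲` is closed — given the cusp action and the law `[Π_X : Π_X̲] = l`.
([IUTchI] Cor 1.2 p.39) [claim: Mochizuki2012, status: disputed] -/
theorem CuspGalois.H_le_piXbar (C : D.CuspGalois) (hX : D.PiXbar.relIndex D.PiX = D.l) :
    (⁅D.PiX ⊓ D.DeltaC, D.PiX ⊓ D.DeltaC⁆ ⊔
      Subgroup.closure ((fun y : D.PiC => y ^ D.l) '' (D.PiX ⊓ D.DeltaC : Set D.PiC))).topologicalClosure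
      ≤ D.PiXbar := by
  have hclosed : IsClosed (D.PiXbar : Set D.PiC) :=
    D.PiXbar.isClosed_of_isOpen (D.isOpen_piX.inter D.isOpen_piCbar)
  obtain ⟨γ, -, hgen⟩ := C.exists_generator
  refine Subgroup.topologicalClosure_minimal _ (sup_le ?_ ?_) hclosed
  · -- commutators: `Π_X` acts on the cusps through the cyclic group generated by `act γ`
    rw [Subgroup.commutator_le]
    intro a ha b hb
    refine (C.mem_PiXbar_iff_act_eq_one₀ (D.PiX.mul_mem (D.PiX.mul_mem (D.PiX.mul_mem ha.1 hb.1)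
      (D.PiX.inv_mem ha.1)) (D.PiX.inv_mem hb.1))).mpr ?_
    obtain ⟨n, hn⟩ := hgen a ha.1
    obtain ⟨m, hm⟩ := hgen b hb.1
    rw [map_mul, map_mul, map_mul, map_inv, map_inv, hn, hm]
    group
  · -- `l`-th powers: `Π_X̲ ⊴ Π_X` has index `[Π_X : Π_X̲] = l`
    rw [Subgroup.closure_le]
    rintro _ ⟨a, ha, rfl⟩
    haveI := C.normal_PiXbar_subgroupOf₀
    have hidx : (D.PiXbar.subgroupOf D.PiX).index = D.l := hX
    have hmem := Subgroup.pow_index_mem (D.PiXbar.subgroupOf D.PiX) (⟨a, ha.1⟩ : D.PiX)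
    rw [hidx, Subgroup.mem_subgroupOf, SubgroupClass.coe_pow] at hmem
    exact hmem

/-- **Cor. 1.2, proof p. 39 — "`Π_X̲ ⊆ Π_C` may be recovered via the [easily verified] equality of
subgroups `Π_X̲ = Π_{X̲→} · H`", `H := Ker(Δ_X ↠ Δ_X^{ab} ⊗ (ℤ/lℤ))`** (the closed subgroup of the frozen
hypothesis (∗) `star`), under the printed claims of p. 38, the cusp action and the law `[Π_X : Π_X̲] = l`.
([IUTchI] Cor 1.2 p.39) [claim: Mochizuki2012, status: disputed] -/
theorem ArrowCoveringClaims.piXarrow_sup_H_eq_piXbar (h : D.ArrowCoveringClaims) (C : D.CuspGalois)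
    (hX : D.PiXbar.relIndex D.PiX = D.l) :
    D.piXarrow ⊔ (⁅D.PiX ⊓ D.DeltaC, D.PiX ⊓ D.DeltaC⁆ ⊔
      Subgroup.closure ((fun y : D.PiC => y ^ D.l) '' (D.PiX ⊓ D.DeltaC : Set D.PiC))).topologicalClosure
      = D.PiXbar :=
  h.piXarrow_sup_eq_piXbar C (C.H_le_piXbar hX) fun g hg x hx =>
    D.star g hg x (deltaXbar_le_deltaX (D.inertia_le_deltaXbar D.ε1 hx))

/-! ### Transport: `Π_X̲` from the [AbsTopII] Cor. 3.3 outputs `Π_{X̲→} ⊆ Π_C`, `Δ_X ⊆ Δ_C` -/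

/-- A bicontinuous isomorphism carries topological closures of subgroups to topological closures
(folklore; used on p. 39 to transport `H`). [cite: Mochizuki2012, Cor 1.2 p.39] -/
theorem map_topologicalClosure_of_bicontinuous {G G' : Type*} [Group G] [TopologicalSpace G]
    [IsTopologicalGroup G] [Group G'] [TopologicalSpace G'] [IsTopologicalGroup G'] (Θ : G ≃* G')
    (hc : Continuous Θ) (hc' : Continuous Θ.symm) (S : Subgroup G) :
    S.topologicalClosure.map Θ.toMonoidHom = (S.map Θ.toMonoidHom).topologicalClosure := by
  apply SetLike.coe_injective
  let e : G ≃ₜ G' := { Θ.toEquiv with continuous_toFun := hc, continuous_invFun := hc' }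
  rw [Subgroup.coe_map, Subgroup.topologicalClosure_coe, Subgroup.topologicalClosure_coe,
    Subgroup.coe_map]
  exact e.image_closure (S : Set G)

/-- `Θ(H) = H'` for `H = Ker(Δ_X ↠ Δ_X^{ab} ⊗ ℤ/lℤ)` whenever the bicontinuous `Θ` carries `Δ_X` onto
`Δ'_X` and `l = l'`. ([IUTchI] Cor 1.2 p.39) [claim: Mochizuki2012, status: disputed] -/
theorem map_H_eq {D' : PuncturedEllipticData.{u}} (Θ : D.PiC ≃* D'.PiC) (hc : Continuous Θ)
    (hc' : Continuous Θ.symm) (hΘX : (D.PiX ⊓ D.DeltaC).map Θ.toMonoidHom = D'.PiX ⊓ D'.DeltaC)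
    (hl : D.l = D'.l) :
    (⁅D.PiX ⊓ D.DeltaC, D.PiX ⊓ D.DeltaC⁆ ⊔ Subgroup.closure
        ((fun y : D.PiC => y ^ D.l) '' (D.PiX ⊓ D.DeltaC : Set D.PiC))).topologicalClosure.map
        Θ.toMonoidHom =
      (⁅D'.PiX ⊓ D'.DeltaC, D'.PiX ⊓ D'.DeltaC⁆ ⊔ Subgroup.closure
        ((fun y : D'.PiC => y ^ D'.l) '' (D'.PiX ⊓ D'.DeltaC : Set D'.PiC))).topologicalClosure := by
  rw [map_topologicalClosure_of_bicontinuous Θ hc hc', Subgroup.map_sup, Subgroup.map_commutator, hΘX,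
    MonoidHom.map_closure, Set.image_image]
  congr 3
  have hset : ((D'.PiX : Set D'.PiC) ⊓ (D'.DeltaC : Set D'.PiC)) =
      Θ '' ((D.PiX : Set D.PiC) ⊓ (D.DeltaC : Set D.PiC)) := by
    show ((D'.PiX : Set D'.PiC) ∩ D'.DeltaC) = Θ '' ((D.PiX : Set D.PiC) ∩ D.DeltaC)
    rw [← Subgroup.coe_inf, ← Subgroup.coe_inf, ← hΘX, Subgroup.coe_map]
    rfl
  rw [hset, Set.image_image]
  refine Set.image_congr' fun y => ?_
  simp only [MulEquiv.coe_toMonoidHom, map_pow, hl]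

/-- **Cor. 1.2, proof p. 39 — `Π_X̲` reconstructed, transport form (the printed route):** for data
`D, D'` satisfying the printed claims of p. 38 and the law `[Π_X : Π_X̲] = l`, with cusp actions, any
bicontinuous isomorphism `Θ : Π_C ⥲ Π'_C` carrying `Π_{X̲→}`, `Δ_X`, `Δ_C` onto `Π'_{X̲→}`, `Δ'_X`, `Δ'_C`
[the outputs of the [AbsTopI] Thm. 2.6 / [AbsTopII] Cor. 3.3 steps] carries `Π_X̲` onto `Π'_X̲`
(`Π_X̲ = Π_{X̲→} · H`, `l` recovered first).  No Remark 1.2.1 / normaliser input is used.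
([IUTchI] Cor 1.2 p.39) [claim: Mochizuki2012, status: disputed] -/
theorem ArrowCoveringClaims.map_piXbar_eq_of_map_deltaX {D' : PuncturedEllipticData.{u}}
    (h : D.ArrowCoveringClaims) (h' : D'.ArrowCoveringClaims) (C : D.CuspGalois) (C' : D'.CuspGalois)
    (hX : D.PiXbar.relIndex D.PiX = D.l) (hX' : D'.PiXbar.relIndex D'.PiX = D'.l)
    (Θ : D.PiC ≃* D'.PiC) (hc : Continuous Θ) (hc' : Continuous Θ.symm)
    (hΘ : D.piXarrow.map Θ.toMonoidHom = D'.piXarrow)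
    (hΘX : (D.PiX ⊓ D.DeltaC).map Θ.toMonoidHom = D'.PiX ⊓ D'.DeltaC)
    (hΘΔ : D.DeltaC.map Θ.toMonoidHom = D'.DeltaC) :
    D.PiXbar.map Θ.toMonoidHom = D'.PiXbar := by
  have hl : D.l = D'.l := h.l_eq_of_map_deltaC h' hX hX' Θ hΘ hΘΔ
  rw [← h.piXarrow_sup_H_eq_piXbar C hX, ← h'.piXarrow_sup_H_eq_piXbar C' hX', Subgroup.map_sup, hΘ,
    map_H_eq Θ hc hc' hΘX hl]

end PuncturedEllipticData

end Literature.IUT.HodgeTheaters
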